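import Mathlib
import Summits.ResolutionOfSingularities.ResolutionOfSingularities.Theorems.WildQuotientsWildQuotientResolutionS1W1NCone

/-!
# S1 / W1N cascade — Part VII.4: the quantitative O-step `μ(C) + 2 ≤ μ(Q)` unless the cone of `Q` is a cube in the direction of `C`

Crux stmt-ResolutionOfSingularities-17941 (`WildQuotients.CyclicQuotientFourfolds`), S1a line `s1a-logminvertex`,
stub `stub_W1N_print`, sub-line `w1n-cascade` (idea-1 `W1N-LINE.md`; proofs from `CombinedW1NPrint.scratch.lean`
f33256b0cfc42851).  [OURS · L1 W4.5c] — NOT a statement of the manuscript; counted 0 post-V5.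

`ostep_arith₂` (the only exception to a drop `≥ 2` in the O-step arithmetic is `mg = 3 = eG`),
`milnor_add_two_le_of_isSuccChart1_zero` (then `G(0,y)` has order 3 and the 3-jet of `g` is `g₀₃·y³`, i.e.
`HasTriple`), `milnor_add_two_le_of_isSucc` (B3 transport, `HasTriple` being shear/swap invariant).
-/

-- single-problem summit: the doubled namespace component `ResolutionOfSingularities` is forced
set_option linter.dupNamespace false

noncomputable section

open MvPowerSeries IsLocalRing
open Literature.AlgebraicGeometry.Resolution
open Summit.ResolutionOfSingularities.ResolutionOfSingularities.Theorems.WildCones.MuDropCharTwoOrdP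

namespace Summit.ResolutionOfSingularities.ResolutionOfSingularities.Theorems.WildQuotientResolution.S1.PlanarField

variable {κ : Type} [Field κ]

/-! ### VII.4 The quantitative O-step: drop `≥ 2` unless the cone is a cube in the direction of the step -/

/-- The arithmetic of the quantitative O-step: in the notation of `ostep_arith`, `μ' + 2 ≤ μ` unless
`mg = 3 ∧ eG = 3` (then `ma = 2`, `α = 1`, `β = 0`). [OURS · L1 W4.5c] -/
theorem ostep_arith₂ {μ μ' ma mb mg s α β fA eG IAG IAB : ℕ}
    (h2a : 2 ≤ ma) (h2b : 2 ≤ mb) (hmg : min ma mb + 1 ≤ mg)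
    (hsα : s + α = ma) (hsβ : s + 2 + β = mg) (hsat : α = 0 ∨ β = 0)
    (hF1 : IAB + ma * mb ≤ μ) (hF2 : (s + 1 + β) * fA + IAG = mb * fA + IAB)
    (hF3 : fA ≤ ma) (hF4 : eG ≤ mg) (hN2 : mb < ma → mg = mb + 1 ∧ eG ≤ mb)
    (hμ' : μ' = α * eG + β * fA + IAG) : μ' + 2 ≤ μ ∨ (mg = 3 ∧ eG = 3) := by
  rcases Nat.lt_or_ge mb ma with hab | hab
  · -- mb < ma : case N2
    left
    obtain ⟨hmg1, heG⟩ := hN2 hab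
    obtain ⟨d, rfl⟩ : ∃ d, ma = mb + d := ⟨ma - mb, by omega⟩
    rcases hsat with hα | hβ
    · exfalso; omega
    · subst hβ
      have hs : s + 1 = mb := by omega
      have hα : α = d + 1 := by omega
      rw [add_zero, hs] at hF2
      have hIAG : IAG = IAB := Nat.add_left_cancel hF2
      have hαe : α * eG ≤ α * mb := Nat.mul_le_mul_left α heG
      have hαm : α * mb = d * mb + mb := by rw [hα]; ring
      have hb2 : 2 * mb ≤ mb * mb := Nat.mul_le_mul_right mb h2b
      nlinarith [hF1, hμ', hIAG, hαe, hαm, hb2, h2b]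
  · -- ma ≤ mb : cases N1 and D
    obtain ⟨d, rfl⟩ : ∃ d, mb = ma + d := ⟨mb - ma, by omega⟩
    have hmg' : ma + 1 ≤ mg := by
      rw [min_eq_left (by omega)] at hmg; exact hmg
    have hd : d * fA ≤ d * ma := Nat.mul_le_mul_left d hF3
    have ha2 : 2 * ma ≤ ma * ma := Nat.mul_le_mul_right ma h2a
    rcases hsat with hα | hβ
    · subst hα
      have hs : s = ma := by omega
      subst hs
      left
      nlinarith [hF1, hF2, hd, hμ', ha2, h2a]
    · subst hβ
      have hα1 : α ≤ 1 := by omega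
      rcases Nat.le_one_iff_eq_zero_or_eq_one.mp hα1 with hα | hα
      · subst hα
        have hs : s = ma := by omega
        subst hs
        left
        nlinarith [hF1, hF2, hd, hμ', ha2, h2a]
      · subst hα
        have hs : s + 1 = ma := by omega
        have hmg2 : mg = s + 2 := by omega
        have hsf : (s + 1) * fA = ma * fA := by rw [hs]
        rcases Nat.lt_or_ge eG (s + 2) with hlt | hge
        · left
          have heG : eG ≤ ma := by omega
          nlinarith [hF1, hF2, hd, hμ', hsf, ha2, h2a, heG]
        · rcases Nat.lt_or_ge s 2 with hs2 | hs2
          · right; omega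
          · left
            have heG : eG = ma + 1 := by omega
            have h3a : 3 ≤ ma := by omega
            have ha3 : 3 * ma ≤ ma * ma := Nat.mul_le_mul_right ma h3a
            nlinarith [hF1, hF2, hd, hμ', hsf, ha3, h3a, heG]

/-- **The quantitative O-step, chart 1 at 0.**  At a chart-1-at-0 successor of an isolated bad node `θ` of
type O, an isolated successor `θ'` has `μ(θ') + 2 ≤ μ(θ)` — UNLESS the cubic cone `P₃(θ)` (the 3-jet of
`x·b − y·a`) is `λ·y³` with `λ ≠ 0`, i.e. `HasTriple θ` holds in the direction of the step (then only
`μ(θ') + 1 ≤ μ(θ)`, `OStep`).  Proof: `ostep_arith₂`; in the exceptional case `mg = 3 = eG` the axis series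
`G(0,y) = g₃(1,y)` has order `3`, so `g₃₀ = g₂₁ = g₁₂ = 0 ≠ g₀₃`. [OURS · L1 W4.5c] -/
theorem milnor_add_two_le_of_isSuccChart1_zero (θ θ' : PlanarField κ) (hiso : θ.IsIsolated)
    (hbad : θ.IsBadNode) (hL : θ.linearPart = 0) (hsucc : IsSuccChart1 0 θ θ') (hiso' : θ'.IsIsolated) :
    θ'.milnor + 2 ≤ θ.milnor ∨
      ∃ lam u v : κ, lam ≠ 0 ∧ (u ≠ 0 ∨ v ≠ 0) ∧
        X 0 * θ.b - X 1 * θ.a - C lam * (C u * X 0 + C v * X 1) ^ 3 ∈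
          maximalIdeal (MvPowerSeries (Fin 2) κ) ^ 4 := by
  obtain ⟨hsing, -⟩ := hbad
  obtain ⟨ha0, hb0⟩ := ne_zero_of_isIsolated θ hiso hsing
  obtain ⟨h2a, h2b⟩ := (linearPart_eq_zero_iff_two_le_order θ hsing).mp hL
  have hg0 : X 0 * θ.b - X 1 * θ.a ≠ 0 := X_mul_sub_ne_zero θ hiso h2a
  obtain ⟨A, Bst, G, ma, mb, mg, s, α, β, hma, hmb, hmg, hmgb, hA, hKA, hνA, hB, hKB, hνB, hG, hKG, hνG,
    hsα, hsβ, hsat, ha', hb', hid, hfinAG, hμ'⟩ := exists_chart1_zero_setup θ θ' ha0 hb0 hg0 hsucc hiso'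
  have h2a' : 2 ≤ ma := by rw [← hma] at h2a; exact_mod_cast h2a
  have h2b' : 2 ≤ mb := by rw [← hmb] at h2b; exact_mod_cast h2b
  have hxA : ¬ (X 0 : MvPowerSeries (Fin 2) κ) ∣ A := (killCompl_ne_zero_iff_not_X_dvd A).mp hKA
  -- `fA ≤ ma`, `eG ≤ mg`
  obtain ⟨-, hfA⟩ := colength_X_eq_order hKA
  obtain ⟨-, heG⟩ := colength_X_eq_order hKG
  have hfA' : Module.finrank κ (MvPowerSeries (Fin 2) κ ⧸ Ideal.span {A, (X 0 : MvPowerSeries (Fin 2) κ)}) =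
      (killCompl (⟨fun _ => (1 : Fin 2), fun a b _ => Subsingleton.elim a b⟩ : Fin 1 ↪ Fin 2) A).order.toNat := by
    rw [Ideal.span_pair_comm]; exact hfA
  have heG' : Module.finrank κ (MvPowerSeries (Fin 2) κ ⧸ Ideal.span {G, (X 0 : MvPowerSeries (Fin 2) κ)}) =
      (killCompl (⟨fun _ => (1 : Fin 2), fun a b _ => Subsingleton.elim a b⟩ : Fin 1 ↪ Fin 2) G).order.toNat := by
    rw [Ideal.span_pair_comm]; exact heG
  have hF3 : Module.finrank κ (MvPowerSeries (Fin 2) κ ⧸ Ideal.span {A, (X 0 : MvPowerSeries (Fin 2) κ)}) ≤ ma := by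
    rw [hfA']; exact ENat.toNat_le_of_le_coe hνA
  have hF4 : Module.finrank κ (MvPowerSeries (Fin 2) κ ⧸ Ideal.span {G, (X 0 : MvPowerSeries (Fin 2) κ)}) ≤ mg := by
    rw [heG']; exact ENat.toNat_le_of_le_coe hνG
  -- colength identity and Noether
  obtain ⟨hfinAB, hF2⟩ := colength_identity hKA hid hfinAG
  have hF1 : Module.finrank κ (MvPowerSeries (Fin 2) κ ⧸ Ideal.span {A, Bst}) + ma * mb ≤ θ.milnor :=
    noether_inequality (mf := ma) (mg := mb) hma.le hmb.le hA hB hKA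
      (hνA.trans (by exact_mod_cast Nat.le_add_right ma mb)) hiso hfinAB
  -- case N2 data
  have hN2 : mb < ma → mg = mb + 1 ∧
      Module.finrank κ (MvPowerSeries (Fin 2) κ ⧸ Ideal.span {G, (X 0 : MvPowerSeries (Fin 2) κ)}) ≤ mb := by
    intro hlt
    have hmb1 : mb + 1 ≤ mg := by rw [min_eq_right hlt.le] at hmgb; exact hmgb
    obtain ⟨t, ht⟩ : ∃ t, s + 1 + β = mb + t := ⟨s + 1 + β - mb, by omega⟩
    obtain ⟨d, hd⟩ : ∃ d, ma = mb + (d + 1) := ⟨ma - mb - 1, by omega⟩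
    have hid' : X 0 ^ t * G = Bst - X 1 * X 0 ^ (d + 1) * A := by
      apply mul_left_cancel₀ (pow_ne_zero mb (X_zero_ne_zero (κ := κ)))
      calc X 0 ^ mb * (X 0 ^ t * G) = X 0 ^ (s + 1 + β) * G := by rw [ht, pow_add, mul_assoc]
        _ = X 0 ^ mb * Bst - X 1 * X 0 ^ ma * A := hid
        _ = X 0 ^ mb * (Bst - X 1 * X 0 ^ (d + 1) * A) := by rw [hd, pow_add]; ring
    have h0 : (0 : Fin 2) ∉ Set.range (⟨fun _ => (1 : Fin 2), fun a b _ => Subsingleton.elim a b⟩ : Fin 1 ↪ Fin 2) :=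
      fun ⟨i, hi⟩ => by simp at hi
    have hK := congrArg (killCompl (R := κ) (⟨fun _ => (1 : Fin 2), fun a b _ => Subsingleton.elim a b⟩ : Fin 1 ↪ Fin 2)) hid'
    simp only [map_mul, map_pow, map_sub, killCompl_X_eq_zero h0, zero_pow (Nat.succ_ne_zero d), mul_zero,
      zero_mul, sub_zero] at hK
    rcases Nat.eq_zero_or_pos t with ht0 | htpos
    · rw [ht0, pow_zero, one_mul] at hK
      refine ⟨by omega, ?_⟩
      rw [heG', hK]
      exact ENat.toNat_le_of_le_coe hνB
    · exfalso
      rw [zero_pow htpos.ne', zero_mul] at hK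
      exact hKB hK.symm
  rcases ostep_arith₂ h2a' h2b' hmgb hsα hsβ hsat hF1 hF2 hF3 hF4 hN2 hμ' with hle | ⟨hmg3, heG3⟩
  · exact Or.inl hle
  · -- the exceptional case: `G(0,y)` has order `3`, so the 3-jet of `g` is `g₀₃·y³`, `g₀₃ ≠ 0`
    right
    have hordG : (killCompl (⟨fun _ => (1 : Fin 2), fun a b _ => Subsingleton.elim a b⟩ : Fin 1 ↪ Fin 2) G).order
        = ((3 : ℕ) : ℕ∞) := by
      have hfin := ne_zero_iff_order_finite.mp hKG
      rw [← hfin, ← heG', heG3]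
    have hk : ∀ k < 3, coeff (Finsupp.single 1 k) G = 0 := by
      intro k hk
      rw [← coeff_killCompl_axis]
      exact coeff_of_lt_order (by rw [hordG, Finsupp.degree_single]; exact_mod_cast hk)
    have h3 : coeff (Finsupp.single 1 3) G ≠ 0 := by
      intro h0
      have h4 := le_order_killCompl (G := G) (n := 4) fun k hk4 => by
        rcases Nat.lt_or_ge k 3 with h | h
        · exact hk k h
        · obtain rfl : k = 3 := by omega
          exact h0
      rw [hordG] at h4
      have : (4 : ℕ) ≤ 3 := by exact_mod_cast h4
      omega
    have hg3 : X 0 * θ.b - X 1 * θ.a ∈ maximalIdeal (MvPowerSeries (Fin 2) κ) ^ 3 :=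
      Literature.RingTheory.MvPowerSeries.Jets.mem_maximalIdeal_pow_of_le_order (by rw [← hmg, hmg3])
    have hg_coeff : ∀ i j : ℕ, i + j = 3 →
        coeff (Finsupp.single 0 i + Finsupp.single 1 j) (X 0 * θ.b - X 1 * θ.a) = coeff (Finsupp.single 1 j) G := by
      intro i j hij
      have h1 := coeff_subst_blow' (X 0 * θ.b - X 1 * θ.a) i j
      rw [hij, hG, hmg3, coeff_add_X_pow_mul] at h1
      exact h1.symm
    refine ⟨coeff (Finsupp.single 1 3) G, 0, 1, h3, Or.inr one_ne_zero, ?_⟩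
    refine mem_maximalIdeal_pow_of_coeff_pair 4 fun i j hij => ?_
    rw [map_sub, coeff_C_mul, coeff_pair_cube]
    rcases Nat.lt_or_ge (i + j) 3 with hlt | hge
    · rw [coeff_pair_eq_zero_of_mem_maximalIdeal_pow hg3 hlt]
      have c1 : ¬ (i = 3 ∧ j = 0) := by omega
      have c2 : ¬ (i = 2 ∧ j = 1) := by omega
      have c3 : ¬ (i = 1 ∧ j = 2) := by omega
      have c4 : ¬ (i = 0 ∧ j = 3) := by omega
      simp [c1, c2, c3, c4]
    · have hij3 : i + j = 3 := by omega
      rw [hg_coeff i j hij3]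
      have hj : j ≤ 3 := by omega
      interval_cases j
      · obtain rfl : i = 3 := by omega
        rw [hk 0 (by norm_num)]; simp
      · obtain rfl : i = 2 := by omega
        rw [hk 1 (by norm_num)]; simp
      · obtain rfl : i = 1 := by omega
        rw [hk 2 (by norm_num)]; simp
      · obtain rfl : i = 0 := by omega
        simp

/-- **The quantitative O-step, any successor** (B3 transport; `HasTriple` is shear/swap invariant).
[OURS · L1 W4.5c] -/
theorem milnor_add_two_le_of_isSucc (θ θ' : PlanarField κ) (hiso : θ.IsIsolated) (hbad : θ.IsBadNode)
    (hL : θ.linearPart = 0)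
    (hT : ¬ ∃ lam u v : κ, lam ≠ 0 ∧ (u ≠ 0 ∨ v ≠ 0) ∧
      X 0 * θ.b - X 1 * θ.a - C lam * (C u * X 0 + C v * X 1) ^ 3 ∈ maximalIdeal (MvPowerSeries (Fin 2) κ) ^ 4)
    (hsucc : θ.IsSucc θ') (hiso' : θ'.IsIsolated) : θ'.milnor + 2 ≤ θ.milnor := by
  revert hiso hbad hL hT hiso'
  refine forall_isSucc_of_chart1_zero
    (P := fun θ θ' => θ.IsIsolated → θ.IsBadNode → θ.linearPart = 0 →
      (¬ ∃ lam u v : κ, lam ≠ 0 ∧ (u ≠ 0 ∨ v ≠ 0) ∧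
        X 0 * θ.b - X 1 * θ.a - C lam * (C u * X 0 + C v * X 1) ^ 3 ∈
          maximalIdeal (MvPowerSeries (Fin 2) κ) ^ 4) →
      θ'.IsIsolated → θ'.milnor + 2 ≤ θ.milnor)
    ?_ ?_ ?_ θ θ' hsucc
  · intro c θ θ' h hiso hbad hL hT hiso'
    have := h ((isIsolated_shear_iff c θ).mpr hiso) ((isBadNode_shear_iff c θ).mpr hbad)
      ((linearPart_shear_eq_zero_iff c θ).mpr hL) (fun hT' => hT ((hasTriple_shear_iff c θ).mp hT')) hiso'
    rwa [milnor_shear] at this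
  · intro θ θ' h hiso hbad hL hT hiso'
    have := h ((isIsolated_swapField_iff θ).mpr hiso) ((isBadNode_swapField_iff θ).mpr hbad)
      ((linearPart_swapField_eq_zero_iff θ).mpr hL) (fun hT' => hT ((hasTriple_swapField_iff θ).mp hT'))
      ((isIsolated_swapField_iff θ').mpr hiso')
    rwa [milnor_swapField, milnor_swapField] at this
  · intro θ θ' h hiso hbad hL hT hiso'
    rcases milnor_add_two_le_of_isSuccChart1_zero θ θ' hiso hbad hL h hiso' with h2 | hT'
    · exact h2
    · exact absurd hT' hT

end Summit.ResolutionOfSingularities.ResolutionOfSingularities.Theorems.WildQuotientResolution.S1.PlanarField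

end
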